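import Literature.RingTheory.MvPolynomial.GenericTwoByNMinors
import Literature.AlgebraicGeometry.Kloosterman2025.GeneralFibreHilbertFunctions
import HarnessLib

/-!
# Kloosterman 2025, Remark 6.7: the Hilbert function of the GENERAL fibre `I_t` (the `2 × 2` minors of the `2 × 4`
# matrix `A_t` of linear forms — a quartic scroll) and "the Hilbert functions of `I_t` and of its limit coincide"

R. Kloosterman, *On a conjecture on Hodge loci of linear combinations of linear subvarieties*, Rend. Circ. Mat.
Palermo (2) 74 (2025) = arXiv:2312.12363 [cite: Kloosterman2025, Remark 6.7] (text read: `paper:arxiv-2312.12363`, p. 17):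

> **Remark 6.7.** If `L₀₃ = 0` then there is a different degeneration. Consider `A_t` the matrix
> `((−L₁₅, L₀₅, x₃, x₄), (x₀, x₁, −tL₂₄, tL₂₃))`. Then the ideal `I_t` of `2 × 2` minors of `A_t` is generated by
> `x₀x₃ − tL₂₄L₁₅, x₀x₄ + tL₁₅L₂₃, x₁x₃ + tL₂₄L₀₅, x₁x₄ − tL₀₅L₂₃, x₀L₀₅ + x₁L₁₅, t(x₃L₂₃ + x₄L₂₄)`. Denote these
> six minors with `f₁, …, f₆` respectively. Consider now `L₀₃f₁ + L₀₄f₂ + L₁₃f₃ + L₁₄f₄ + x₅f₅ + x₂f₆`. If we substitute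
> `t = 0` then we recover our original `f`. The limit
> for `I_t` when `t → 0` is generated by `x₀x₃, x₀x₄, x₁x₃, x₁x₄, x₀L₀₅ + x₁L₁₅, x₃L₂₃ + x₄L₂₄`, which is the
> intersection of `(x₀, x₁, x₃L₂₃ + x₄L₂₄)` and `(x₃, x₄, x₀L₀₅ + x₁L₁₅)`. […] In this case we have a degeneration of a
> quartic subscheme, whereas in the above proof we used a quintic subscheme.

The tree's `FlatLimitHilbertFunctions.lean` has the CENTRAL fibre (`scrollLimitIdeal T`,
`hilbert_scrollLimitIdeal_eq_scrollSection`: `χ_w + 3χ_w(·−1)`, `w = n − 2 − #T`) and records "the postulation of the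
general fibre (the `2 × 2` minors of `A_t`) is not formalised here"; the model postulation is the tree's
`GenericTwoByNMinors.hilbert_twoMinorIdeal_two_by_four` (`2 × 2` minors of a GENERIC `2 × 4` matrix: `χ₅ + 3χ₅(·−1)`,
[cite: BrunsHerzog1998, Thm. 7.2.7 / proof of Thm. 7.3.6] [cite: Harris1992, Example 18.15]); the base change (cones,
killed tail coordinates, substitution of independent linear forms) is `GeneralFibreHilbertFunctions.lean`
(`hilbert_map_aeval_sup_span_of_linearIndependent`). THIS FILE:

* **`hilbert_map_twoMinorIdeal_two_by_four`** — a `2 × 4` matrix of eight linearly independent linear forms in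
  `K[x_0, …, x_n]` (`n ≥ 7`): the ideal of its `2 × 2` minors has Hilbert function `χ_{n−2}(m) + 3χ_{n−2}(m−1)`
  (an iterated cone over the Segre fourfold `ℙ¹ × ℙ³ ⊂ ℙ⁷`, Hilbert series `(1 + 3s)/(1 − s)^{n−2}`);
* `scroll_combination_eq` (any commutative ring): `L₀₃f₁ + L₀₄f₂ + L₁₃f₃ + L₁₄f₄ + x₅f₅ + x₂·(f₆/t)
  = f|_{L₂₅=0} + t·det L|_{L₂₅=0}` with the tree's `cubicNormalForm` / `detL` — "we recover our original `f`" holds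
  exactly when `L₂₅ = 0` (the remark's "If `L₀₃ = 0`" (sic) = the `L₂₅ = 0` normalisation of its last paragraph), and
  **`deformedCubic_mem_scrollFibreIdeal`** (`X_t ⊃ Y_t`: `f|_{L₂₅=0} + t·det L + h ∈ I_t + (x_T)` for `t ≠ 0`, `h ∈ (x_T)`);
* `scrollSubst` (`A_t` as a substitution for the generic `2 × 4` matrix), `scrollFibreIdeal T …` (`I_t + (x_T)`),
  **`scrollFibreIdeal_eq_span`** (`I_t` is generated by the six printed forms — the minors of `A_t` up to sign),
  **`hilbert_scrollFibreIdeal_of_linearIndependent`** (`χ_w + 3χ_w(·−1)`, `w = n − 2 − #T`, when the eight entries and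
  the tail coordinates `x_T` are linearly independent, `#T + 7 ≤ n`), **`remark_6_7_hilbert_fibre_eq_hilbert_limit`**
  (`h_{I_t + (x_T)} = h_{lim I_t}` with the tree's `scrollLimitIdeal T`, under independence + the tree's CI hypotheses).

Scope (say exactly what is NOT covered): the ITERATED-CONE regime only — eight entries `∪ x_T` linearly independent
(`#T + 7 ≤ n`; printed case `n = 2k+1`, `T = {k+4, …, 2k+1}`: `k ≥ 4`, `L_{ij}` general); for `k = 2, 3` the general
fibre is a proper linear section of the scroll cone (needs Cohen–Macaulayness; not formalised). Flatness as a
`K[t]`-module statement, the classes `h − [Π₁] + h − [Π₂]`, and "`a = b = 1`" are not formalised. 0 sorry; no named facts.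

HONEST FRAMING (cell pub-hlocus): certified instances and evidence bearing on the general Hodge conjecture; no claim.

## References

* [Kloosterman2025] R. Kloosterman, *On a conjecture on Hodge loci of linear combinations of linear subvarieties*,
  Rend. Circ. Mat. Palermo (2) 74 (2025); arXiv:2312.12363, Remark 6.7.
* [BrunsHerzog1998] W. Bruns, J. Herzog, *Cohen–Macaulay Rings*, rev. ed. (1998), Def. 4.1.1, Remark 4.1.11, Thm. 7.2.7,
  proof of Thm. 7.3.6.
* [Harris1992] J. Harris, *Algebraic Geometry: A First Course*, GTM 133 (1992), Example 18.15.
-/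

noncomputable section

open MvPolynomial Module

attribute [local instance] MvPolynomial.gradedAlgebra

namespace Literature.AlgebraicGeometry.Kloosterman2025

open Literature.RingTheory.MvPolynomial Literature.RingTheory.HilbertSamuel

universe u

variable {K : Type u} [Field K]

/-- `Ideal.map` only depends on the underlying function. [folklore] -/
private theorem ideal_map_congr' {R S F G : Type*} [Semiring R] [Semiring S] [FunLike F R S] [RingHomClass F R S]
    [FunLike G R S] [RingHomClass G R S] (f : F) (g : G) (h : ∀ x, f x = g x) (I : Ideal R) :
    I.map f = I.map g := by
  unfold Ideal.map
  congr 1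
  ext y
  constructor
  · rintro ⟨x, hx, rfl⟩; exact ⟨x, hx, (h x).symm⟩
  · rintro ⟨x, hx, rfl⟩; exact ⟨x, hx, h x⟩

/-! ## §9a `X_t ⊃ Y_t` in Remark 6.7: the printed combination of the six minors of `A_t` (a ring identity) -/

section Rem67Combination

variable {R : Type*} [CommRing R]

/-- **Remark 6.7's combination** `L₀₃f₁ + L₀₄f₂ + L₁₃f₃ + L₁₄f₄ + x₅f₅ + x₂·(x₃L₂₃ + x₄L₂₄)` of the `2 × 2` minors of
`A_t` (the last minor, printed `f₆ = t(x₃L₂₃ + x₄L₂₄)`, divided by `t`) equals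
`Σ_{(i,j) ≠ (2,5)} xᵢxⱼL_{ij} + t·det(L_{ij})|_{L₂₅ = 0}` — Kloosterman's normal form `f` (the tree's `cubicNormalForm`)
with `L₂₅ = 0`, deformed in the direction `det L` (the tree's `detL`; sign of `t` opposite to Prop. 6.4's `f_t`):
"Consider now `L₀₃f₁ + L₀₄f₂ + L₁₃f₃ + L₁₄f₄ + x₅f₅ + x₂f₆`. If we substitute `t = 0` then we recover our original
`f`." This kernel-checked identity shows that the hypothesis under which this holds is `L₂₅ = 0` (the term `x₂x₅L₂₅`
of `f` is the one that no minor of `A_t` produces) — the remark's opening "If `L₀₃ = 0`" (sic) is to be read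
"`L₂₅ = 0`", the coordinate change its last paragraph discusses ("we can always find a change of coordinates such
that `L₂₅ = 0`"). [cite: Kloosterman2025, Remark 6.7] -/
theorem scroll_combination_eq (x₀ x₁ x₂ x₃ x₄ x₅ L₀₃ L₀₄ L₀₅ L₁₃ L₁₄ L₁₅ L₂₃ L₂₄ t : R) :
    L₀₃ * (x₀ * x₃ - t * L₂₄ * L₁₅) + L₀₄ * (x₀ * x₄ + t * L₁₅ * L₂₃) + L₁₃ * (x₁ * x₃ + t * L₂₄ * L₀₅) +
          L₁₄ * (x₁ * x₄ - t * L₀₅ * L₂₃) + x₅ * (x₀ * L₀₅ + x₁ * L₁₅) + x₂ * (x₃ * L₂₃ + x₄ * L₂₄) =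
      cubicNormalForm x₀ x₁ x₂ x₃ x₄ x₅ L₀₃ L₀₄ L₀₅ L₁₃ L₁₄ L₁₅ L₂₃ L₂₄ 0 +
        t * detL L₀₃ L₀₄ L₀₅ L₁₃ L₁₄ L₁₅ L₂₃ L₂₄ 0 := by
  unfold cubicNormalForm detL
  ring

end Rem67Combination

/-! ## §9 Remark 6.7: the general fibre `I_t`, `t ≠ 0` — an iterated cone over the Segre fourfold `ℙ¹ × ℙ³ ⊂ ℙ⁷` -/

section Rem67Fibre

variable {n : ℕ}

local notation "𝓗(" I ", " m ")" =>
  (((finrank K (homogeneousSubmodule (Fin (n + 1)) K m) - finrank K (idealDegree I m) : ℕ) : ℤ))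

open Literature.RingTheory.MvPolynomial.GenericTwoByNMinors Literature.AlgebraicGeometry.Kloosterman2023 in
/-- **The general fibre of Remark 6.7 at the level of a `2 × 4` matrix of linear forms**: if the eight entries (a family
`a` on `Fin (4 + 4)`: first row `a (castAdd 4 j)`, second row `a (natAdd 4 j)`) are linearly independent linear forms of
`K[x_0, …, x_n]` (`n ≥ 7`), the ideal of `2 × 2` minors (the image of the tree's `GenericTwoByNMinors.twoMinorIdeal K 4`)
has Hilbert function `χ_{n−2}(m) + 3χ_{n−2}(m−1)` — Hilbert series `(1 + 3s)/(1 − s)^{n−2}`, an iterated cone over the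
quartic scroll `ℙ¹ × ℙ³ ⊂ ℙ⁷` (`GenericTwoByNMinors.hilbert_twoMinorIdeal_two_by_four` [cite: Harris1992, Example 18.15]).
[cite: Kloosterman2025, Remark 6.7 ("a degeneration of a quartic subscheme")] -/
theorem hilbert_map_twoMinorIdeal_two_by_four (a : Fin (4 + 4) → MvPolynomial (Fin (n + 1)) K)
    (ha : ∀ s, (a s).IsHomogeneous 1) (hli : LinearIndependent K a) (hn : 7 ≤ n) (m : ℕ) :
    𝓗((twoMinorIdeal K 4).map (aeval a : MvPolynomial (Fin (4 + 4)) K →ₐ[K] MvPolynomial (Fin (n + 1)) K), m) =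
      chi (n - 2) m + 3 * chi (n - 2) ((m : ℤ) - 1) := by
  rw [hilbert_map_aeval_of_linearIndependent (twoMinorIdeal K 4) a ha hli m, Fintype.card_fin]
  have h := coneHF_chi (h := fun i => finrank K (homogeneousSubmodule (Fin (4 + 4)) K i) -
      finrank K (idealDegree (twoMinorIdeal K 4) i)) (v := 5) (by norm_num) 1 3 0
    (fun d => by simpa using hilbert_twoMinorIdeal_chi (K := K) (n := 4) (by norm_num) d) (n + 1 - (4 + 4)) m
  rw [show 5 + (n + 1 - (4 + 4)) = n - 2 by omega] at h
  simpa using h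

variable (T : Finset (Fin (n + 1))) (i₀ i₁ i₃ i₄ : Fin (n + 1)) (L₀₅ L₁₅ L₂₃ L₂₄ : MvPolynomial (Fin (n + 1)) K)
  (t : K)

/-- **The matrix `A_t` of Remark 6.7**, rows `(−L₁₅, L₀₅, x₃, x₄)` and `(x₀, x₁, −tL₂₄, tL₂₃)`, as a substitution for the
generic `2 × 4` matrix of `GenericTwoByNMinors` (first row ↦ the `x`-variables `castAdd`, second row ↦ the `y`-variables
`natAdd`). [cite: Kloosterman2025, Remark 6.7] -/
def scrollSubst : Fin (4 + 4) → MvPolynomial (Fin (n + 1)) K :=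
  Fin.append ![-L₁₅, L₀₅, X i₃, X i₄] ![X i₀, X i₁, -(C t * L₂₄), C t * L₂₃]

open Literature.RingTheory.MvPolynomial.GenericTwoByNMinors in
/-- **The ideal `I_t` of `2 × 2` minors of `A_t`**, together with the tail coordinates `x_T` (the image of the generic
`twoMinorIdeal K 4` under the substitution `A_t`, plus `(x_t : t ∈ T)`; printed case `T = {k+4, …, 2k+1}`).
[cite: Kloosterman2025, Remark 6.7] -/
def scrollFibreIdeal : Ideal (MvPolynomial (Fin (n + 1)) K) :=
  (twoMinorIdeal K 4).map (aeval (scrollSubst i₀ i₁ i₃ i₄ L₀₅ L₁₅ L₂₃ L₂₄ t) :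
    MvPolynomial (Fin (4 + 4)) K →ₐ[K] MvPolynomial (Fin (n + 1)) K) ⊔ Ideal.span (X '' (T : Set (Fin (n + 1))))

/-- The six pairs of columns of a `2 × 4` matrix. [folklore] -/
private theorem pair_four_cases (s : Literature.RingTheory.MvPolynomial.Pluecker.Pair 4) :
    s = ⟨(0, 1), by decide⟩ ∨ s = ⟨(0, 2), by decide⟩ ∨ s = ⟨(0, 3), by decide⟩ ∨ s = ⟨(1, 2), by decide⟩ ∨
      s = ⟨(1, 3), by decide⟩ ∨ s = ⟨(2, 3), by decide⟩ := by
  obtain ⟨⟨i, j⟩, hij⟩ := s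
  have key : ∀ i j : Fin 4, i < j → (i = 0 ∧ j = 1) ∨ (i = 0 ∧ j = 2) ∨ (i = 0 ∧ j = 3) ∨ (i = 1 ∧ j = 2) ∨
      (i = 1 ∧ j = 3) ∨ (i = 2 ∧ j = 3) := by
    decide
  rcases key i j hij with ⟨rfl, rfl⟩ | ⟨rfl, rfl⟩ | ⟨rfl, rfl⟩ | ⟨rfl, rfl⟩ | ⟨rfl, rfl⟩ | ⟨rfl, rfl⟩
  · exact Or.inl rfl
  · exact Or.inr (Or.inl rfl)
  · exact Or.inr (Or.inr (Or.inl rfl))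
  · exact Or.inr (Or.inr (Or.inr (Or.inl rfl)))
  · exact Or.inr (Or.inr (Or.inr (Or.inr (Or.inl rfl))))
  · exact Or.inr (Or.inr (Or.inr (Or.inr (Or.inr rfl))))

open Literature.RingTheory.MvPolynomial.GenericTwoByNMinors Literature.RingTheory.MvPolynomial.Pluecker in
/-- **"Then the ideal `I_t` of `2 × 2` minors of `A_t` is generated by `x₀x₃ − tL₂₄L₁₅, x₀x₄ + tL₁₅L₂₃, x₁x₃ + tL₂₄L₀₅,
x₁x₄ − tL₀₅L₂₃, x₀L₀₅ + x₁L₁₅, t(x₃L₂₃ + x₄L₂₄)`"** — the six minors of `A_t` are these six forms up to sign (columns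
`(1,3), (1,4), (2,3), (2,4), (1,2)` give their negatives, `(3,4)` gives the last one). [cite: Kloosterman2025, Remark 6.7] -/
theorem scrollFibreIdeal_eq_span :
    scrollFibreIdeal T i₀ i₁ i₃ i₄ L₀₅ L₁₅ L₂₃ L₂₄ t =
      Ideal.span {X i₀ * X i₃ - C t * L₂₄ * L₁₅, X i₀ * X i₄ + C t * L₁₅ * L₂₃, X i₁ * X i₃ + C t * L₂₄ * L₀₅,
        X i₁ * X i₄ - C t * L₀₅ * L₂₃, X i₀ * L₀₅ + X i₁ * L₁₅, C t * (X i₃ * L₂₃ + X i₄ * L₂₄)} ⊔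
        Ideal.span (X '' (T : Set (Fin (n + 1)))) := by
  set A := scrollSubst i₀ i₁ i₃ i₄ L₀₅ L₁₅ L₂₃ L₂₄ t with hA
  have hmin : ∀ s : Pair 4, aeval A (minor K 4 s) =
      A (Fin.castAdd 4 s.1.1) * A (Fin.natAdd 4 s.1.2) - A (Fin.castAdd 4 s.1.2) * A (Fin.natAdd 4 s.1.1) := by
    intro s
    simp only [minor, map_sub, map_mul, aeval_X]
  have r0 : ∀ j, A (Fin.castAdd 4 j) = ![-L₁₅, L₀₅, X i₃, X i₄] j := fun j => by rw [hA, scrollSubst, Fin.append_left]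
  have r1 : ∀ j, A (Fin.natAdd 4 j) = ![X i₀, X i₁, -(C t * L₂₄), C t * L₂₃] j := fun j => by
    rw [hA, scrollSubst, Fin.append_right]
  have g01 : aeval A (minor K 4 ⟨(0, 1), by decide⟩) = -(X i₀ * L₀₅ + X i₁ * L₁₅) := by
    rw [hmin]; simp only [r0, r1]; simp; ring
  have g02 : aeval A (minor K 4 ⟨(0, 2), by decide⟩) = -(X i₀ * X i₃ - C t * L₂₄ * L₁₅) := by
    rw [hmin]; simp only [r0, r1]; simp; ring
  have g03 : aeval A (minor K 4 ⟨(0, 3), by decide⟩) = -(X i₀ * X i₄ + C t * L₁₅ * L₂₃) := by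
    rw [hmin]; simp only [r0, r1]; simp; ring
  have g12 : aeval A (minor K 4 ⟨(1, 2), by decide⟩) = -(X i₁ * X i₃ + C t * L₂₄ * L₀₅) := by
    rw [hmin]; simp only [r0, r1]; simp; ring
  have g13 : aeval A (minor K 4 ⟨(1, 3), by decide⟩) = -(X i₁ * X i₄ - C t * L₀₅ * L₂₃) := by
    rw [hmin]; simp only [r0, r1]; simp; ring
  have g23 : aeval A (minor K 4 ⟨(2, 3), by decide⟩) = C t * (X i₃ * L₂₃ + X i₄ * L₂₄) := by
    rw [hmin]; simp only [r0, r1]; simp; ring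
  rw [scrollFibreIdeal, twoMinorIdeal, ideal_map_congr'
    (aeval A : MvPolynomial (Fin (4 + 4)) K →ₐ[K] MvPolynomial (Fin (n + 1)) K)
    ((aeval A : MvPolynomial (Fin (4 + 4)) K →ₐ[K] MvPolynomial (Fin (n + 1)) K) :
      MvPolynomial (Fin (4 + 4)) K →+* MvPolynomial (Fin (n + 1)) K) (fun x => rfl), Ideal.map_span, ← Set.range_comp]
  congr 1
  refine le_antisymm (Ideal.span_le.mpr ?_) (Ideal.span_le.mpr ?_)
  · rintro _ ⟨s, rfl⟩
    rw [Function.comp_apply]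
    rcases pair_four_cases s with rfl | rfl | rfl | rfl | rfl | rfl
    · erw [g01]; exact neg_mem_iff.mpr (Ideal.subset_span (by simp))
    · erw [g02]; exact neg_mem_iff.mpr (Ideal.subset_span (by simp))
    · erw [g03]; exact neg_mem_iff.mpr (Ideal.subset_span (by simp))
    · erw [g12]; exact neg_mem_iff.mpr (Ideal.subset_span (by simp))
    · erw [g13]; exact neg_mem_iff.mpr (Ideal.subset_span (by simp))
    · erw [g23]; exact Ideal.subset_span (by simp)
  · have mem : ∀ s : Pair 4, aeval A (minor K 4 s) ∈
        Ideal.span (Set.range ((aeval A : MvPolynomial (Fin (4 + 4)) K →ₐ[K] MvPolynomial (Fin (n + 1)) K) ∘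
          minor K 4)) := fun s => Ideal.subset_span ⟨s, rfl⟩
    intro f hf
    simp only [Set.mem_insert_iff, Set.mem_singleton_iff] at hf
    rcases hf with rfl | rfl | rfl | rfl | rfl | rfl
    · have := mem ⟨(0, 2), by decide⟩; rw [g02] at this; exact neg_mem_iff.mp this
    · have := mem ⟨(0, 3), by decide⟩; rw [g03] at this; exact neg_mem_iff.mp this
    · have := mem ⟨(1, 2), by decide⟩; rw [g12] at this; exact neg_mem_iff.mp this
    · have := mem ⟨(1, 3), by decide⟩; rw [g13] at this; exact neg_mem_iff.mp this
    · have := mem ⟨(0, 1), by decide⟩; rw [g01] at this; exact neg_mem_iff.mp this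
    · have := mem ⟨(2, 3), by decide⟩; rw [g23] at this; exact this

/-- **`X_t ⊃ Y_t` in Remark 6.7**: for `t ≠ 0` (`u·t = 1`) the deformed cubic
`f|_{L₂₅ = 0} + t·det L|_{L₂₅ = 0} + h`, with `h ∈ (x_T)` (the tail `H = Σ_{j ∈ T} x_j Q_j` of the normal form), lies in
`I_t + (x_T)`: it is `L₀₃f₁ + L₀₄f₂ + L₁₃f₃ + L₁₄f₄ + x₅f₅ + (x₂/t)·f₆ + h` (`scroll_combination_eq`).
[cite: Kloosterman2025, Remark 6.7] -/
theorem deformedCubic_mem_scrollFibreIdeal (i₂ i₅ : Fin (n + 1)) (L₀₃ L₀₄ L₁₃ L₁₄ : MvPolynomial (Fin (n + 1)) K)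
    (u : K) (hu : u * t = 1) {h : MvPolynomial (Fin (n + 1)) K}
    (hh : h ∈ Ideal.span (X '' (T : Set (Fin (n + 1))))) :
    cubicNormalForm (X i₀) (X i₁) (X i₂) (X i₃) (X i₄) (X i₅) L₀₃ L₀₄ L₀₅ L₁₃ L₁₄ L₁₅ L₂₃ L₂₄ 0 +
        C t * detL L₀₃ L₀₄ L₀₅ L₁₃ L₁₄ L₁₅ L₂₃ L₂₄ 0 + h ∈
      scrollFibreIdeal T i₀ i₁ i₃ i₄ L₀₅ L₁₅ L₂₃ L₂₄ t := by
  rw [scrollFibreIdeal_eq_span]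
  refine Submodule.add_mem_sup ?_ hh
  have hCt : C u * C t = (1 : MvPolynomial (Fin (n + 1)) K) := by rw [← C_mul, hu, C_1]
  have e6 : X i₂ * (X i₃ * L₂₃ + X i₄ * L₂₄) = (C u * X i₂) * (C t * (X i₃ * L₂₃ + X i₄ * L₂₄)) := by
    linear_combination (-(X i₂ * (X i₃ * L₂₃ + X i₄ * L₂₄))) * hCt
  rw [← scroll_combination_eq, e6]
  refine Ideal.add_mem _ (Ideal.add_mem _ (Ideal.add_mem _ (Ideal.add_mem _ (Ideal.add_mem _ ?_ ?_) ?_) ?_) ?_) ?_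
  all_goals exact Ideal.mul_mem_left _ _ (Ideal.subset_span (by simp))

open Literature.RingTheory.MvPolynomial.GenericTwoByNMinors Literature.AlgebraicGeometry.Kloosterman2023 in
/-- **Remark 6.7, the general fibre in Kloosterman's coordinates** (in `ℙⁿ`, tail coordinates `x_T` included): if the
eight entries of `A_t` together with the tail variables `x_t`, `t ∈ T`, are linear and linearly independent
(`#T + 7 ≤ n`; printed case `n = 2k+1`, `T = {k+4, …, 2k+1}`, so `k ≥ 4`; for `t ≠ 0`: `x₀, x₁, x₃, x₄, L₀₅, L₁₅, L₂₃,
L₂₄, x_T` independent), then `h_{I_t + (x_T)}(m) = χ_w(m) + 3χ_w(m−1)`, `w = n − 2 − #T` — Hilbert series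
`(1 + 3s)/(1 − s)^{w}`, a quartic scroll ("a degeneration of a quartic subscheme"). [cite: Kloosterman2025, Remark 6.7] -/
theorem hilbert_scrollFibreIdeal_of_linearIndependent
    (hL : ∀ s, (scrollSubst i₀ i₁ i₃ i₄ L₀₅ L₁₅ L₂₃ L₂₄ t s).IsHomogeneous 1)
    (hli : LinearIndependent K (Sum.elim (scrollSubst i₀ i₁ i₃ i₄ L₀₅ L₁₅ L₂₃ L₂₄ t)
      (fun s : T => (X (s : Fin (n + 1)) : MvPolynomial (Fin (n + 1)) K))))
    (hT : T.card + 7 ≤ n) (m : ℕ) :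
    𝓗(scrollFibreIdeal T i₀ i₁ i₃ i₄ L₀₅ L₁₅ L₂₃ L₂₄ t, m) =
      chi (n - 2 - T.card) m + 3 * chi (n - 2 - T.card) ((m : ℤ) - 1) := by
  have hX : Ideal.span (X '' (T : Set (Fin (n + 1)))) =
      Ideal.span (Set.range fun s : T => (X (s : Fin (n + 1)) : MvPolynomial (Fin (n + 1)) K)) := by
    rw [Set.image_eq_range]
    rfl
  rw [scrollFibreIdeal, hX,
    hilbert_map_aeval_sup_span_of_linearIndependent (twoMinorIdeal K 4) _ _ hL (fun s => isHomogeneous_X K _) hli m,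
    Fintype.card_fin, Fintype.card_coe]
  have h := coneHF_chi (h := fun i => finrank K (homogeneousSubmodule (Fin (4 + 4)) K i) -
      finrank K (idealDegree (twoMinorIdeal K 4) i)) (v := 5) (by norm_num) 1 3 0
    (fun d => by simpa using hilbert_twoMinorIdeal_chi (K := K) (n := 4) (by norm_num) d) (n + 1 - (4 + 4 + T.card)) m
  rw [show 5 + (n + 1 - (4 + 4 + T.card)) = n - 2 - T.card by omega] at h
  simpa using h

variable {T i₀ i₁ i₃ i₄ L₀₅ L₁₅ L₂₃ L₂₄ t}

open Literature.AlgebraicGeometry.Kloosterman2023 in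
/-- **The Hilbert functions of `I_t` (`t ≠ 0`) and of its limit coincide (Remark 6.7)**, in the iterated-cone regime:
with the tail coordinates `x_T` on both sides, the general fibre (eight entries of `A_t` and `x_T` linearly independent,
`#T + 7 ≤ n`) and the central fibre `⟨x₀x₃, x₀x₄, x₁x₃, x₁x₄, N, M⟩ + (x_T)` (the tree's `scrollLimitIdeal T` with
`N = x₀L₀₅ + x₁L₁₅ ∈ ⟨x₀, x₁⟩`, `M = x₃L₂₃ + x₄L₂₄ ∈ ⟨x₃, x₄⟩`, under its complete-intersection hypotheses
`hilbert_scrollLimitIdeal_eq_scrollSection`) both have Hilbert function `χ_w(m) + 3χ_w(m−1)`, `w = n − 2 − #T` —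
the flatness numerics of the quartic-scroll degeneration. [cite: Kloosterman2025, Remark 6.7] -/
theorem remark_6_7_hilbert_fibre_eq_hilbert_limit {N M : MvPolynomial (Fin (n + 1)) K}
    (hL : ∀ s, (scrollSubst i₀ i₁ i₃ i₄ L₀₅ L₁₅ L₂₃ L₂₄ t s).IsHomogeneous 1)
    (hli : LinearIndependent K (Sum.elim (scrollSubst i₀ i₁ i₃ i₄ L₀₅ L₁₅ L₂₃ L₂₄ t)
      (fun s : T => (X (s : Fin (n + 1)) : MvPolynomial (Fin (n + 1)) K))))
    (hT : T.card + 7 ≤ n)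
    (h₀₁ : i₀ ≠ i₁) (h₀₃ : i₀ ≠ i₃) (h₀₄ : i₀ ≠ i₄) (h₁₃ : i₁ ≠ i₃) (h₁₄ : i₁ ≠ i₄) (h₃₄ : i₃ ≠ i₄)
    (hi₀ : i₀ ∉ T) (hi₁ : i₁ ∉ T) (hi₃ : i₃ ∉ T) (hi₄ : i₄ ∉ T)
    (hNA : N ∈ Ideal.span {(X i₀ : MvPolynomial (Fin (n + 1)) K), X i₁})
    (hMB : M ∈ Ideal.span {(X i₃ : MvPolynomial (Fin (n + 1)) K), X i₄})
    (hNh : N.IsHomogeneous 2) (hMh : M.IsHomogeneous 2)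
    (hM : M ∉ Ideal.span (X '' (({i₀, i₁} : Set (Fin (n + 1))) ∪ ↑T)))
    (hN : N ∉ Ideal.span (X '' (({i₃, i₄} : Set (Fin (n + 1))) ∪ ↑T)))
    (m : ℕ) :
    𝓗(scrollFibreIdeal T i₀ i₁ i₃ i₄ L₀₅ L₁₅ L₂₃ L₂₄ t, m) = 𝓗(scrollLimitIdeal T i₀ i₁ i₃ i₄ N M, m) := by
  rw [hilbert_scrollFibreIdeal_of_linearIndependent T i₀ i₁ i₃ i₄ L₀₅ L₁₅ L₂₃ L₂₄ t hL hli hT m,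
    hilbert_scrollLimitIdeal_eq_scrollSection h₀₁ h₀₃ h₀₄ h₁₃ h₁₄ h₃₄ hi₀ hi₁ hi₃ hi₄ hNA hMB hNh hMh hM hN
      (by omega) m]

end Rem67Fibre

end Literature.AlgebraicGeometry.Kloosterman2025
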